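import Literature.MathematicalPhysics.QuantumLattice.SectorSpectrum
import Literature.MathematicalPhysics.QuantumLattice.SectorEigenvalueContinuation
import Literature.MathematicalPhysics.QuantumLattice.ApproximateEigenvectorLemmas

/-!
# `SgAnchorOrder` (route `ColourTheSpin`, stmt-HubbardSuperconductivity-16273) — negative lane, file 1/3:
# block quadratic forms, crude bounds, link averaging

Support lemmas for the refutation `ColourTheSpinSgAnchorOrder_refuted`
(`Theorems/ColourTheSpinSgAnchorOrderRefutation.lean`): quadratic forms of `M.toBlock p p` are those of
`M` on zero-extended vectors; the entrywise `ℓ¹` bound `|⟨v,Mv⟩| ≤ (Σ‖M_ij‖)‖v‖²`; Kronecker products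
with `1`/`diagonal` act fibrewise; and the combinatorics of the link averaging `Q_b` on configurations
`B → G` (the `|G|`-to-one reindexing `(k,u) ↦ k[b ↦ u]`, `⟨ψ, Q_bψ⟩ = ‖Q_bψ‖²`). All folklore linear
algebra; no statement of the route is asserted here.
-/

noncomputable section

set_option linter.dupNamespace false

namespace Summit.HubbardSuperconductivity.HubbardSuperconductivity.Theorems

namespace ColourTheSpinSgAnchorOrderRefutation

open scoped BigOperators Matrix ComplexConjugate ComplexOrder
open Literature.MathematicalPhysics.QuantumLattice

/-! ### Part A — general finite-dimensional lemmas -/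

section General

variable {ι : Type*}

section Extension

variable (p : ι → Prop)

/-- Extension by zero (`Function.extend Subtype.val ψ 0`) restricted to the block is the identity.
[folklore] -/
theorem extend_val_apply_coe (ψ : {a // p a} → ℂ) (a : {a // p a}) :
    Function.extend Subtype.val ψ 0 a.1 = ψ a :=
  Subtype.val_injective.extend_apply _ _ a

/-- Extension by zero vanishes off the block. [folklore] -/
theorem extend_val_apply_of_not (ψ : {a // p a} → ℂ) {i : ι} (hi : ¬ p i) :
    Function.extend Subtype.val ψ 0 i = 0 := by
  rw [Function.extend_apply' _ _ _ (fun ⟨a, ha⟩ => hi (ha ▸ a.2)), Pi.zero_apply]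

/-- A vector supported in the block is the zero extension of its restriction. [folklore] -/
theorem extend_val_restrict {φ : ι → ℂ} (hφ : ∀ i, ¬ p i → φ i = 0) :
    Function.extend Subtype.val (fun a : {a // p a} => φ a.1) 0 = φ := by
  funext i
  by_cases hi : p i
  · exact extend_val_apply_coe p (fun a : {a // p a} => φ a.1) ⟨i, hi⟩
  · rw [extend_val_apply_of_not p _ hi, hφ i hi]

end Extension

variable [Fintype ι]

/-- `‖v‖₂² = Σ_i ‖v_i‖²`. [folklore] -/
theorem eucNorm_sq_eq_sum (v : ι → ℂ) : eucNorm v ^ 2 = ∑ i, ‖v i‖ ^ 2 := by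
  rw [eucNorm_sq, EigenvalueContinuation.re_star_dotProduct_self]

/-- Each coordinate is bounded by the Euclidean norm. [folklore] -/
theorem norm_apply_le_eucNorm (v : ι → ℂ) (i : ι) : ‖v i‖ ≤ eucNorm v := by
  have h : ‖v i‖ ^ 2 ≤ eucNorm v ^ 2 := by
    rw [eucNorm_sq_eq_sum]
    exact Finset.single_le_sum (f := fun j => ‖v j‖ ^ 2) (fun j _ => sq_nonneg _) (Finset.mem_univ i)
  nlinarith [h, norm_nonneg (v i), eucNorm_nonneg v]

/-- The entrywise `ℓ¹` mass of a matrix is non-negative. [folklore] -/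
theorem sum_sum_norm_nonneg (M : Matrix ι ι ℂ) : 0 ≤ ∑ i, ∑ j, ‖M i j‖ :=
  Finset.sum_nonneg fun _ _ => Finset.sum_nonneg fun _ _ => norm_nonneg _

/-- Crude bound `|⟨v, M v⟩| ≤ (Σ_{ij} ‖M_{ij}‖) ‖v‖₂²`. [folklore] -/
theorem norm_quadForm_le (M : Matrix ι ι ℂ) (v : ι → ℂ) :
    ‖star v ⬝ᵥ M *ᵥ v‖ ≤ (∑ i, ∑ j, ‖M i j‖) * eucNorm v ^ 2 := by
  have hrepr : star v ⬝ᵥ M *ᵥ v = ∑ i, star (v i) * ∑ j, M i j * v j := rfl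
  rw [hrepr]
  calc ‖∑ i, star (v i) * ∑ j, M i j * v j‖
      ≤ ∑ i, ‖star (v i) * ∑ j, M i j * v j‖ := norm_sum_le _ _
    _ ≤ ∑ i, ∑ j, ‖M i j‖ * eucNorm v ^ 2 := by
        refine Finset.sum_le_sum fun i _ => ?_
        rw [norm_mul, norm_star]
        calc ‖v i‖ * ‖∑ j, M i j * v j‖
            ≤ eucNorm v * ∑ j, ‖M i j‖ * eucNorm v := by
              refine mul_le_mul (norm_apply_le_eucNorm v i) ?_ (norm_nonneg _) (eucNorm_nonneg v)
              calc ‖∑ j, M i j * v j‖ ≤ ∑ j, ‖M i j * v j‖ := norm_sum_le _ _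
                _ ≤ ∑ j, ‖M i j‖ * eucNorm v := Finset.sum_le_sum fun j _ => by
                    rw [norm_mul]
                    exact mul_le_mul_of_nonneg_left (norm_apply_le_eucNorm v j) (norm_nonneg _)
          _ = ∑ j, ‖M i j‖ * eucNorm v ^ 2 := by
              rw [Finset.mul_sum]
              refine Finset.sum_congr rfl fun j _ => ?_
              ring
    _ = (∑ i, ∑ j, ‖M i j‖) * eucNorm v ^ 2 := by
        rw [Finset.sum_mul]
        refine Finset.sum_congr rfl fun i _ => ?_
        rw [Finset.sum_mul]

/-- Crude bound for the real part of a quadratic form. [folklore] -/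
theorem abs_re_quadForm_le (M : Matrix ι ι ℂ) (v : ι → ℂ) :
    |(star v ⬝ᵥ M *ᵥ v).re| ≤ (∑ i, ∑ j, ‖M i j‖) * eucNorm v ^ 2 :=
  (Complex.abs_re_le_norm _).trans (norm_quadForm_le M v)

/-- `⟨x, Aᴴ y⟩ = ⟨A x, y⟩`. [folklore] -/
theorem star_dotProduct_conjTranspose_mulVec (A : Matrix ι ι ℂ) (x y : ι → ℂ) :
    star x ⬝ᵥ Aᴴ *ᵥ y = star (A *ᵥ x) ⬝ᵥ y := by
  rw [Matrix.star_mulVec, ← Matrix.dotProduct_mulVec]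

/-- `Re ⟨x, Aᴴ A x⟩ = ‖A x‖₂²`. [folklore] -/
theorem re_quadForm_conjTranspose_mul_self (A : Matrix ι ι ℂ) (x : ι → ℂ) :
    (star x ⬝ᵥ (Aᴴ * A) *ᵥ x).re = eucNorm (A *ᵥ x) ^ 2 := by
  rw [← Matrix.mulVec_mulVec, star_dotProduct_conjTranspose_mulVec, eucNorm_sq]

/-- Cauchy–Schwarz for finite real sums. -/
theorem sum_mul_le_sqrt_mul_sqrt {κ : Type*} (s : Finset κ) (x y : κ → ℝ) :
    ∑ k ∈ s, x k * y k ≤ Real.sqrt (∑ k ∈ s, x k ^ 2) * Real.sqrt (∑ k ∈ s, y k ^ 2) := by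
  rw [← Real.sqrt_mul (Finset.sum_nonneg fun k _ => sq_nonneg (x k))]
  exact (le_abs_self _).trans (Real.abs_le_sqrt (Finset.sum_mul_sq_le_sq_mul_sq s x y))

/-! #### Blocks: quadratic forms of `M.toBlock p p` are those of `M` on zero-extended vectors -/

variable (p : ι → Prop) [DecidablePred p]

/-- Inner products with a zero-extended vector are block inner products. [folklore] -/
theorem star_extend_dotProduct (ψ : {a // p a} → ℂ) (w : ι → ℂ) :
    star (Function.extend Subtype.val ψ 0) ⬝ᵥ w = star ψ ⬝ᵥ fun a => w a.1 := by
  rw [dotProduct, dotProduct, sum_eq_sum_subtype_of_support p _ (fun i hi => by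
    rw [Pi.star_apply, extend_val_apply_of_not p ψ hi, star_zero, zero_mul])]
  refine Finset.sum_congr rfl fun a _ => ?_
  rw [Pi.star_apply, Pi.star_apply, extend_val_apply_coe]

/-- A matrix applied to a zero-extended vector, entrywise. [folklore] -/
theorem mulVec_extend_apply (M : Matrix ι ι ℂ) (ψ : {a // p a} → ℂ) (i : ι) :
    (M *ᵥ Function.extend Subtype.val ψ 0) i = ∑ a : {a // p a}, M i a.1 * ψ a := by
  rw [Matrix.mulVec, dotProduct, sum_eq_sum_subtype_of_support p _ (fun j hj => by
    rw [extend_val_apply_of_not p ψ hj, mul_zero])]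
  refine Finset.sum_congr rfl fun a _ => ?_
  rw [extend_val_apply_coe]

/-- `M.toBlock p p ψ` is the restriction of `M` applied to the zero extension. [folklore] -/
theorem toBlock_mulVec_apply (M : Matrix ι ι ℂ) (ψ : {a // p a} → ℂ) (a : {a // p a}) :
    (M.toBlock p p *ᵥ ψ) a = (M *ᵥ Function.extend Subtype.val ψ 0) a.1 := by
  rw [mulVec_extend_apply, Matrix.mulVec, dotProduct]
  rfl

/-- **Block quadratic forms are full quadratic forms on zero-extended vectors.** [folklore] -/
theorem block_form (M : Matrix ι ι ℂ) (ψ : {a // p a} → ℂ) :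
    star ψ ⬝ᵥ M.toBlock p p *ᵥ ψ =
      star (Function.extend Subtype.val ψ 0) ⬝ᵥ M *ᵥ Function.extend Subtype.val ψ 0 := by
  rw [star_extend_dotProduct]
  congr 1
  funext a
  exact toBlock_mulVec_apply p M ψ a

/-- The block norm is the norm of the zero extension. [folklore] -/
theorem block_norm (ψ : {a // p a} → ℂ) :
    star ψ ⬝ᵥ ψ = star (Function.extend Subtype.val ψ 0) ⬝ᵥ Function.extend Subtype.val ψ 0 := by
  rw [star_extend_dotProduct]
  congr 1
  funext a
  rw [extend_val_apply_coe]

end General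

/-! ### Part A' — product index bookkeeping -/

section Prod

variable {α β : Type*} [Fintype α] [Fintype β]

/-- `‖v‖₂²` over a product index is the sum of the fibre norms. [folklore] -/
theorem eucNorm_sq_prod (v : α × β → ℂ) :
    eucNorm v ^ 2 = ∑ b, eucNorm (fun a => v (a, b)) ^ 2 := by
  rw [eucNorm_sq_eq_sum, Fintype.sum_prod_type, Finset.sum_comm]
  simp only [eucNorm_sq_eq_sum]

/-- `(1 ⊗ B) v` acts fibrewise in the second index. [folklore] -/
theorem one_kron_mulVec [DecidableEq α] (Bm : Matrix β β ℂ) (v : α × β → ℂ) (a : α) (k : β) :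
    (Matrix.kroneckerMap (· * ·) (1 : Matrix α α ℂ) Bm *ᵥ v) (a, k) = (Bm *ᵥ fun k' => v (a, k')) k := by
  rw [Matrix.mulVec, dotProduct, Fintype.sum_prod_type, Finset.sum_comm, Matrix.mulVec, dotProduct]
  refine Finset.sum_congr rfl fun k' _ => ?_
  simp only [Matrix.kroneckerMap_apply, Matrix.one_apply, ite_mul, one_mul, zero_mul]
  rw [Finset.sum_ite_eq]
  simp only [Finset.mem_univ, if_true]

/-- `(A ⊗ diag d) v` acts as `d(k) · A` on the fibre over `k`. [folklore] -/
theorem kron_diagonal_mulVec [DecidableEq β] (A : Matrix α α ℂ) (d : β → ℂ) (v : α × β → ℂ) (a : α) (k : β) :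
    (Matrix.kroneckerMap (· * ·) A (Matrix.diagonal d) *ᵥ v) (a, k) =
      d k * (A *ᵥ fun a' => v (a', k)) a := by
  rw [Matrix.mulVec, dotProduct, Fintype.sum_prod_type, Matrix.mulVec, dotProduct, Finset.mul_sum]
  refine Finset.sum_congr rfl fun a' _ => ?_
  simp only [Matrix.kroneckerMap_apply, Matrix.diagonal_apply, mul_ite, mul_zero, ite_mul, zero_mul]
  rw [Finset.sum_ite_eq]
  simp only [Finset.mem_univ, if_true]
  ring

end Prod


/-! ### Part B — link-configuration combinatorics -/

section Links

variable {B G : Type*} [DecidableEq B]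

/-- Splitting off the coordinate `b` of an updated configuration. [folklore] -/
theorem funSplitAt_update (b : B) (k : B → G) (u : G) :
    Equiv.funSplitAt b G (Function.update k b u) = (u, (Equiv.funSplitAt b G k).2) := by
  refine Prod.ext ?_ (funext fun j => ?_)
  · show Function.update k b u b = u
    exact Function.update_self ..
  · show Function.update k b u j = k j
    exact Function.update_of_ne j.2 _ _

/-- An updated configuration in split coordinates. [folklore] -/
theorem update_eq_symm (b : B) (k : B → G) (u : G) :
    Function.update k b u = (Equiv.funSplitAt b G).symm (u, (Equiv.funSplitAt b G k).2) := by
  rw [← funSplitAt_update, Equiv.symm_apply_apply]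

/-- Updating the split-off coordinate. [folklore] -/
theorem update_symm (b : B) (v u : G) (k' : {j // j ≠ b} → G) :
    Function.update ((Equiv.funSplitAt b G).symm (v, k')) b u = (Equiv.funSplitAt b G).symm (u, k') := by
  rw [update_eq_symm b, Equiv.apply_symm_apply]

section Sums

variable [Fintype B] [Fintype G]

/-- The `|G|`-to-one reindexing `(k, u) ↦ update k b u`. -/
theorem sum_sum_update {M : Type*} [AddCommMonoid M] (b : B) (F : (B → G) → M) :
    ∑ k, ∑ u, F (Function.update k b u) = Fintype.card G • ∑ k, F k := by
  set e := Equiv.funSplitAt b G with he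
  calc ∑ k, ∑ u, F (Function.update k b u)
      = ∑ k, ∑ u, F (e.symm (u, (e k).2)) := by
        refine Finset.sum_congr rfl fun k _ => Finset.sum_congr rfl fun u _ => ?_
        rw [update_eq_symm]
    _ = ∑ q : G × ({j // j ≠ b} → G), ∑ u, F (e.symm (u, q.2)) :=
        Fintype.sum_equiv e _ _ (fun k => rfl)
    _ = ∑ v : G, ∑ k' : {j // j ≠ b} → G, ∑ u, F (e.symm (u, k')) := Fintype.sum_prod_type _
    _ = Fintype.card G • ∑ k' : {j // j ≠ b} → G, ∑ u, F (e.symm (u, k')) := by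
        rw [Finset.sum_const, Finset.card_univ]
    _ = Fintype.card G • ∑ k, F k := by
        congr 1
        rw [Fintype.sum_equiv e F (fun q => F (e.symm q)) (fun k => by rw [Equiv.symm_apply_apply]),
          Fintype.sum_prod_type, Finset.sum_comm]

/-- The configurations agreeing with `k` off `b` are exactly the `update k b u`. [folklore] -/
theorem sum_ite_eq_update {instBG : DecidableEq (B → G)} (b : B) (k : B → G) (g : (B → G) → ℂ) :
    ∑ k', (if k' = Function.update k b (k' b) then g k' else 0) = ∑ u, g (Function.update k b u) := by
  symm
  calc ∑ u, g (Function.update k b u)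
      = ∑ u, ∑ k', (if k' = Function.update k b u then g k' else 0) := by
        refine Finset.sum_congr rfl fun u _ => ?_
        rw [Finset.sum_ite_eq']
        simp only [Finset.mem_univ, if_true]
    _ = ∑ k', ∑ u, (if k' = Function.update k b u then g k' else 0) := Finset.sum_comm
    _ = ∑ k', (if k' = Function.update k b (k' b) then g k' else 0) := by
        refine Finset.sum_congr rfl fun k' _ => ?_
        by_cases h : k' = Function.update k b (k' b)
        · rw [if_pos h, Finset.sum_eq_single (k' b)]
          · rw [if_pos h]
          · intro u _ hu
            rw [if_neg]
            intro h'
            apply hu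
            rw [h', Function.update_self]
          · intro h'; exact absurd (Finset.mem_univ _) h'
        · rw [if_neg h]
          refine Finset.sum_eq_zero fun u _ => ?_
          rw [if_neg]
          intro h'
          apply h
          have hb : k' b = u := by rw [h', Function.update_self]
          rw [hb]
          exact h'

end Sums

variable {α : Type*} [Fintype G]

variable [Nonempty G]

/-- `|G| ≠ 0` in `ℂ`. [folklore] -/
theorem card_G_ne_zero : (Fintype.card G : ℂ) ≠ 0 := Nat.cast_ne_zero.2 Fintype.card_ne_zero

variable [Fintype B] [Fintype α]

/-- `⟨ψ, Q_b ψ⟩ = ‖Q_b ψ‖²` for the link averaging `(Q_b ψ)(s,k) = |G|⁻¹ Σ_u ψ(s, k[b ↦ u])` (an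
orthogonal projection); `φ` is any function satisfying the averaging formula. [folklore] -/
theorem star_dotProduct_avg (b : B) (ψ φ : α × (B → G) → ℂ)
    (hφ : ∀ s k, φ (s, k) = (1 / (Fintype.card G : ℂ)) * ∑ u, ψ (s, Function.update k b u)) :
    star ψ ⬝ᵥ φ = star φ ⬝ᵥ φ := by
  have hupd : ∀ s k (v : G), φ (s, Function.update k b v) = φ (s, k) := by
    intro s k v
    rw [hφ, hφ]
    simp only [Function.update_idem]
  have hsum : ∀ s k, ∑ u, ψ (s, Function.update k b u) = (Fintype.card G : ℂ) * φ (s, k) := by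
    intro s k
    rw [hφ, ← mul_assoc, mul_one_div_cancel card_G_ne_zero, one_mul]
  rw [dotProduct, dotProduct, Fintype.sum_prod_type, Fintype.sum_prod_type]
  refine Finset.sum_congr rfl fun s _ => ?_
  simp only [Pi.star_apply]
  have h := sum_sum_update (M := ℂ) b (fun k => star (ψ (s, k)) * φ (s, k))
  simp only [hupd] at h
  have h2 : ∀ k : B → G, ∑ u, star (ψ (s, Function.update k b u)) * φ (s, k) =
      (Fintype.card G : ℂ) * (star (φ (s, k)) * φ (s, k)) := by
    intro k
    rw [← Finset.sum_mul, ← star_sum, hsum, star_mul', Complex.star_def, Complex.conj_natCast]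
    ring
  simp only [h2, nsmul_eq_mul] at h
  rw [← Finset.mul_sum] at h
  have h3 := mul_left_cancel₀ card_G_ne_zero h
  exact h3.symm

/-- `⟨Q_b ψ, ψ⟩ = ‖Q_b ψ‖²`. [folklore] -/
theorem star_avg_dotProduct (b : B) (ψ φ : α × (B → G) → ℂ)
    (hφ : ∀ s k, φ (s, k) = (1 / (Fintype.card G : ℂ)) * ∑ u, ψ (s, Function.update k b u)) :
    star φ ⬝ᵥ ψ = star φ ⬝ᵥ φ := by
  rw [Matrix.star_dotProduct, star_dotProduct_avg b ψ φ hφ, ← Matrix.star_dotProduct]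

end Links


end ColourTheSpinSgAnchorOrderRefutation

end Summit.HubbardSuperconductivity.HubbardSuperconductivity.Theorems
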